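import Mathlib
import Summits.QuantumFields.YangMills.Theorems.SpecificationCompactnessGibbsLimitUniquenessDoeblin
import HarnessLib

/-!
# Gibbs uniqueness on a finite product of compact groups — the GENERIC form of route SpecificationCompactness' support S2
# (stmt-QuantumFields-28253): a continuous single-site specification with a positive floor admits at most one compatible law, and
# every specification-merging sequence of absolutely continuous probability laws converges weakly

Generic over the index set `ι` (finite), the single-site space `G` (compact, second countable, Borel) and the reference
probability measure `η` on `G` charging open sets; the laws `ρ_K` are any probability measures on `ι → G` absolutely
continuous with respect to `⊗_ι η`.  This is the statement the critic (idea-crit-5 #116, price (4)) asked to have in reusable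
form: «Feller specification with positive continuous floor on a finite product has a unique consistent probability, and
spec-merging sequences converge to it».  The `SU(2)^{links}` instance for Bałaban's unit laws is
`GibbsLimitUniqueness.gibbsLimitUniqueness_proof` (sibling module).

* `exists_tendsto_integral_of_specMerging` — convergence of `∫ f dρ_K` for every continuous `f`.
* `integral_eq_of_specCompatible` — uniqueness: two probability laws `μ, ν ≪ ⊗η` whose single-site conditional expectations
  ARE the `q`-specification (`E_μ[f | sites ≠ e] = E_{⊗η}[q_e f | sites ≠ e]` in `L¹(μ)`, same for `ν`) have the same integrals of
  continuous functions (apply the convergence theorem to the alternating sequence `μ, ν, μ, ν, …`).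

HONEST FRAMING: [folklore] measure theory (Friedli–Velenik 2017 Thm 6.26 / Lemma 6.27; Doeblin); no YM statement, rung or summit here.
-/

noncomputable section

namespace Summit.QuantumFields.YangMills.Theorems.GibbsLimitUniqueness

open MeasureTheory Filter Topology Function Set

variable {ι : Type*} [Fintype ι] [DecidableEq ι] {G : Type*} [TopologicalSpace G] [CompactSpace G]
  [SecondCountableTopology G] [MeasurableSpace G] [BorelSpace G] [Nonempty G]

/-- **SPECIFICATION-MERGING SEQUENCES CONVERGE** (generic Doeblin–Feller uniqueness on a finite product of compact spaces).
Let `η` be a probability measure on `G` charging open sets, `ρ_K` probability laws on `ι → G` with `ρ_K ≪ ⊗_ι η`, and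
`q = (q_e)` continuous weights with a floor `δ > 0` and unit fibre integrals (`E_{⊗η}[q_e | sites ≠ e] = 1` a.e.).  If for every
site `e` and continuous `f` the conditional expectations merge, `∫ |E_{ρ_K}[f | sites ≠ e] − E_{⊗η}[q_e f | sites ≠ e]| dρ_K → 0`,
then `lim_K ∫ f dρ_K` exists for every continuous `f`. [cite: FriedliVelenik2017, Thm 6.26 and Lemma 6.27] -/
theorem exists_tendsto_integral_of_specMerging (η : Measure G) [IsProbabilityMeasure η] [η.IsOpenPosMeasure]
    (ρ : ℕ → Measure (ι → G)) [∀ K, IsProbabilityMeasure (ρ K)] (hac : ∀ K, ρ K ≪ Measure.pi fun _ : ι => η)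
    {δ : ℝ} (hδ : 0 < δ) (q : ι → (ι → G) → ℝ) (hqc : ∀ e, Continuous (q e)) (hqδ : ∀ e V, δ ≤ q e V)
    (hqn : ∀ e, ∀ᵐ V ∂(Measure.pi fun _ : ι => η),
      (Measure.pi fun _ : ι => η)[q e | MeasurableSpace.comap (fun (W : ι → G) (b : {b // b ≠ e}) => W b.1)
        MeasurableSpace.pi] V = 1)
    (hconv : ∀ e (f : (ι → G) → ℝ), Continuous f → Tendsto (fun K => ∫ V,
      |((ρ K)[f | MeasurableSpace.comap (fun (W : ι → G) (b : {b // b ≠ e}) => W b.1) MeasurableSpace.pi]) V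
        - ((Measure.pi fun _ : ι => η)[fun W => q e W * f W |
            MeasurableSpace.comap (fun (W : ι → G) (b : {b // b ≠ e}) => W b.1) MeasurableSpace.pi]) V| ∂ρ K)
      atTop (𝓝 0))
    {f : (ι → G) → ℝ} (hf : Continuous f) :
    ∃ l : ℝ, Tendsto (fun K => ∫ V, f V ∂ρ K) atTop (𝓝 l) := by
  classical
  set P₀ : Measure (ι → G) := Measure.pi fun _ : ι => η with hP0def
  -- continuous functions on the compact product are bounded and integrable for every finite measure
  have hint : ∀ (μ : Measure (ι → G)) [IsFiniteMeasure μ] (g : (ι → G) → ℝ), Continuous g → Integrable g μ := by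
    intro μ _ g hg
    obtain ⟨C, hC⟩ := isCompact_univ.exists_bound_of_continuousOn (hg.continuousOn (s := Set.univ))
    exact Integrable.of_bound hg.aestronglyMeasurable C (Eventually.of_forall fun V => hC V (Set.mem_univ V))
  have hbounds : ∀ g : (ι → G) → ℝ, Continuous g → ∃ a b : ℝ, ∀ V, a ≤ g V ∧ g V ≤ b := by
    intro g hg
    obtain ⟨C, hC⟩ := isCompact_univ.exists_bound_of_continuousOn (hg.continuousOn (s := Set.univ))
    refine ⟨-C, C, fun V => ?_⟩
    have h := hC V (Set.mem_univ V)
    rw [Real.norm_eq_abs] at h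
    exact abs_le.1 h
  -- (A) the fibre normalisation holds EVERYWHERE
  have hnorm : ∀ e (V : ι → G), ∫ w, q e (Function.update V e w) ∂η = 1 := by
    intro e
    have hkey := condExp_pi_ae_eq_integral_update η e (hqc e).stronglyMeasurable (hint P₀ _ (hqc e))
    have hcont : Continuous fun V : ι → G => ∫ w, q e (Function.update V e w) ∂η :=
      continuous_integral_update η (hqc e) e
    have hae : (fun V : ι → G => ∫ w, q e (Function.update V e w) ∂η) =ᵐ[P₀] fun _ => (1:ℝ) := by
      filter_upwards [hkey, hqn e] with V h1 h2
      rw [← h1]; exact h2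
    have heq := (Continuous.ae_eq_iff_eq P₀ hcont continuous_const).1 hae
    exact fun V => congrFun heq V
  -- (B) one site: `∫ Γ_e g dρ_K − ∫ g dρ_K → 0`
  have hlink : ∀ e (g : (ι → G) → ℝ), Continuous g →
      Tendsto (fun K => ∫ V, (∫ w, q e (Function.update V e w) * g (Function.update V e w) ∂η) ∂ρ K
        - ∫ V, g V ∂ρ K) atTop (𝓝 0) := by
    intro e g hg
    have hS : Measurable (fun (W : ι → G) (b : {b // b ≠ e}) => W b.1) :=
      measurable_pi_lambda _ fun b : {b // b ≠ e} => measurable_pi_apply b.1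
    have hm := hS.comap_le
    have hqg : Continuous fun W : ι → G => q e W * g W := (hqc e).mul hg
    have hkey := condExp_pi_ae_eq_integral_update η e hqg.stronglyMeasurable (hint P₀ _ hqg)
    have hstep : Continuous fun V : ι → G => ∫ w, q e (Function.update V e w) * g (Function.update V e w) ∂η :=
      continuous_integral_update η hqg e
    have h := hconv e g hg
    have hdiff : ∀ K, ∫ V, (∫ w, q e (Function.update V e w) * g (Function.update V e w) ∂η) ∂ρ K - ∫ V, g V ∂ρ K
        = -∫ V, (((ρ K)[g | MeasurableSpace.comap (fun (W : ι → G) (b : {b // b ≠ e}) => W b.1) MeasurableSpace.pi]) V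
            - (P₀[fun W => q e W * g W | MeasurableSpace.comap (fun (W : ι → G) (b : {b // b ≠ e}) => W b.1)
                MeasurableSpace.pi]) V) ∂ρ K := by
      intro K
      have hae : (P₀[fun W => q e W * g W | MeasurableSpace.comap (fun (W : ι → G) (b : {b // b ≠ e}) => W b.1)
            MeasurableSpace.pi]) =ᵐ[ρ K] fun V => ∫ w, q e (Function.update V e w) * g (Function.update V e w) ∂η :=
        (hac K).ae_eq hkey
      have i1 : Integrable ((ρ K)[g | MeasurableSpace.comap (fun (W : ι → G) (b : {b // b ≠ e}) => W b.1)
          MeasurableSpace.pi]) (ρ K) := integrable_condExp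
      have i2 : Integrable (P₀[fun W => q e W * g W | MeasurableSpace.comap (fun (W : ι → G) (b : {b // b ≠ e}) => W b.1)
          MeasurableSpace.pi]) (ρ K) := (hint (ρ K) _ hstep).congr hae.symm
      rw [integral_sub i1 i2, integral_condExp hm, integral_congr_ae hae]
      ring
    rw [show (fun K => ∫ V, (∫ w, q e (Function.update V e w) * g (Function.update V e w) ∂η) ∂ρ K - ∫ V, g V ∂ρ K)
        = fun K => -∫ V, (((ρ K)[g | MeasurableSpace.comap (fun (W : ι → G) (b : {b // b ≠ e}) => W b.1)
              MeasurableSpace.pi]) V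
            - (P₀[fun W => q e W * g W | MeasurableSpace.comap (fun (W : ι → G) (b : {b // b ≠ e}) => W b.1)
                MeasurableSpace.pi]) V) ∂ρ K from funext hdiff]
    rw [← neg_zero]
    refine Tendsto.neg (squeeze_zero_norm (fun K => ?_) h)
    rw [Real.norm_eq_abs]
    exact abs_integral_le_integral_abs
  -- (C) sweeps
  have hsweep : ∀ (l : List ι) (g : (ι → G) → ℝ), Continuous g →
      Tendsto (fun K => ∫ V, l.foldr (fun e g' => fun V : ι → G =>
        ∫ w, q e (Function.update V e w) * g' (Function.update V e w) ∂η) g V ∂ρ K - ∫ V, g V ∂ρ K) atTop (𝓝 0) := by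
    intro l g hg
    induction l with
    | nil => simp only [List.foldr_nil, sub_self]; exact tendsto_const_nhds
    | cons e l ih =>
      have hcl : Continuous (l.foldr (fun e g' => fun V : ι → G =>
          ∫ w, q e (Function.update V e w) * g' (Function.update V e w) ∂η) g) := continuous_sweep η hqc hg l
      have h2 := (hlink e (l.foldr (fun e g' => fun V : ι → G =>
          ∫ w, q e (Function.update V e w) * g' (Function.update V e w) ∂η) g) hcl).add ih
      rw [add_zero] at h2
      refine h2.congr' (Eventually.of_forall fun K => ?_)
      simp only [List.foldr_cons]
      ring
  -- (D) Doeblin over an enumeration of the sites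
  set l₀ : List ι := (Finset.univ : Finset ι).toList with hl₀
  have hl₀mem : ∀ i : ι, i ∈ l₀ := fun i => Finset.mem_toList.2 (Finset.mem_univ i)
  have hone : ∀ e (V : ι → G), ∫ w, (fun (_ : ι) (_ : ι → G) => (1:ℝ)) e (Function.update V e w) ∂η = 1 := by
    intro e V; simp
  obtain ⟨g0⟩ := ‹Nonempty G›
  haveI : Nonempty (ι → G) := ⟨fun _ => g0⟩
  refine exists_tendsto_of_doeblin (fun g => Continuous g)
    (fun g => l₀.foldr (fun e g' => fun V : ι → G =>
        ∫ w, q e (Function.update V e w) * g' (Function.update V e w) ∂η) g)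
    (fun g => l₀.foldr (fun e g' => fun V : ι → G =>
        ∫ w, (fun (_ : ι) (_ : ι → G) => (1:ℝ)) e (Function.update V e w) * g' (Function.update V e w) ∂η) g
        (fun _ => g0))
    (fun K g => ∫ V, g V ∂ρ K) (pow_pos hδ l₀.length)
    (fun g hg => continuous_sweep η hqc hg l₀)
    (fun g a b hg => (continuous_const.mul hg).add continuous_const)
    hbounds
    (fun g a b hg => sweep_affine η hqc hnorm hg a b l₀)
    (fun g a b hg => ?_) (fun g hg hg0 V => ?_) (fun K g a b hg hab => ?_) (fun g hg => hsweep l₀ g hg) hf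
  · have h := sweep_affine η (q := fun (_ : ι) (_ : ι → G) => (1:ℝ)) (fun _ => continuous_const) hone hg a b l₀
    exact congrFun h _
  · have h := sweep_ge_pow_mul_pureSweep η hqc hδ.le hqδ hg hg0 l₀ V
    rw [pureSweep_eq_of_eqOn_compl η l₀ V (fun _ => g0) (fun i hi => absurd (hl₀mem i) hi)] at h
    exact h
  · have hgi : Integrable g (ρ K) := hint (ρ K) g hg
    constructor
    · have h := integral_mono (integrable_const a) hgi (fun V => (hab V).1)
      simpa using h
    · have h := integral_mono hgi (integrable_const b) (fun V => (hab V).2)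
      simpa using h


/-- **UNIQUENESS OF THE LAW COMPATIBLE WITH A CONTINUOUS POSITIVE-FLOOR SPECIFICATION** (Friedli–Velenik Thm 6.26-type statement on
a finite product, via Doeblin): if two probability laws `μ, ν ≪ ⊗_ι η` both have the `q`-specification as their single-site conditional
expectations (`∫ |E_μ[f | sites ≠ e] − E_{⊗η}[q_e f | sites ≠ e]| dμ = 0` for all `e` and continuous `f`, and the same for `ν`), then
`∫ f dμ = ∫ f dν` for every continuous `f` — apply `exists_tendsto_integral_of_specMerging` to the alternating sequence
`μ, ν, μ, ν, …`. [cite: FriedliVelenik2017, Thm 6.26 and Lemma 6.27] -/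
theorem integral_eq_of_specCompatible (η : Measure G) [IsProbabilityMeasure η] [η.IsOpenPosMeasure]
    (μ ν : Measure (ι → G)) [IsProbabilityMeasure μ] [IsProbabilityMeasure ν]
    (hμac : μ ≪ Measure.pi fun _ : ι => η) (hνac : ν ≪ Measure.pi fun _ : ι => η)
    {δ : ℝ} (hδ : 0 < δ) (q : ι → (ι → G) → ℝ) (hqc : ∀ e, Continuous (q e)) (hqδ : ∀ e V, δ ≤ q e V)
    (hqn : ∀ e, ∀ᵐ V ∂(Measure.pi fun _ : ι => η),
      (Measure.pi fun _ : ι => η)[q e | MeasurableSpace.comap (fun (W : ι → G) (b : {b // b ≠ e}) => W b.1)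
        MeasurableSpace.pi] V = 1)
    (hμ : ∀ e (f : (ι → G) → ℝ), Continuous f → ∫ V,
      |(μ[f | MeasurableSpace.comap (fun (W : ι → G) (b : {b // b ≠ e}) => W b.1) MeasurableSpace.pi]) V
        - ((Measure.pi fun _ : ι => η)[fun W => q e W * f W |
            MeasurableSpace.comap (fun (W : ι → G) (b : {b // b ≠ e}) => W b.1) MeasurableSpace.pi]) V| ∂μ = 0)
    (hν : ∀ e (f : (ι → G) → ℝ), Continuous f → ∫ V,
      |(ν[f | MeasurableSpace.comap (fun (W : ι → G) (b : {b // b ≠ e}) => W b.1) MeasurableSpace.pi]) V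
        - ((Measure.pi fun _ : ι => η)[fun W => q e W * f W |
            MeasurableSpace.comap (fun (W : ι → G) (b : {b // b ≠ e}) => W b.1) MeasurableSpace.pi]) V| ∂ν = 0)
    {f : (ι → G) → ℝ} (hf : Continuous f) :
    ∫ V, f V ∂μ = ∫ V, f V ∂ν := by
  classical
  -- the alternating sequence `μ, ν, μ, ν, …`
  set ρ : ℕ → Measure (ι → G) := fun K => if Even K then μ else ν with hρ
  have hρe : ∀ K, Even K → ρ K = μ := fun K hK => by simp [hρ, hK]
  have hρo : ∀ K, ¬ Even K → ρ K = ν := fun K hK => by simp [hρ, hK]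
  haveI : ∀ K, IsProbabilityMeasure (ρ K) := fun K => by
    by_cases hK : Even K
    · rw [hρe K hK]; infer_instance
    · rw [hρo K hK]; infer_instance
  have hac : ∀ K, ρ K ≪ Measure.pi fun _ : ι => η := fun K => by
    by_cases hK : Even K
    · rw [hρe K hK]; exact hμac
    · rw [hρo K hK]; exact hνac
  have hconv : ∀ e (g : (ι → G) → ℝ), Continuous g → Tendsto (fun K => ∫ V,
      |((ρ K)[g | MeasurableSpace.comap (fun (W : ι → G) (b : {b // b ≠ e}) => W b.1) MeasurableSpace.pi]) V
        - ((Measure.pi fun _ : ι => η)[fun W => q e W * g W |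
            MeasurableSpace.comap (fun (W : ι → G) (b : {b // b ≠ e}) => W b.1) MeasurableSpace.pi]) V| ∂ρ K)
      atTop (𝓝 0) := by
    intro e g hg
    refine (tendsto_const_nhds (x := (0:ℝ))).congr' (Eventually.of_forall fun K => ?_)
    show (0:ℝ) = ∫ V,
      |((ρ K)[g | MeasurableSpace.comap (fun (W : ι → G) (b : {b // b ≠ e}) => W b.1) MeasurableSpace.pi]) V
        - ((Measure.pi fun _ : ι => η)[fun W => q e W * g W |
            MeasurableSpace.comap (fun (W : ι → G) (b : {b // b ≠ e}) => W b.1) MeasurableSpace.pi]) V| ∂ρ K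
    by_cases hK : Even K
    · have h := hμ e g hg
      rw [← hρe K hK] at h
      exact h.symm
    · have h := hν e g hg
      rw [← hρo K hK] at h
      exact h.symm
  obtain ⟨l, hl⟩ := exists_tendsto_integral_of_specMerging η ρ hac hδ q hqc hqδ hqn hconv hf
  -- even and odd subsequences
  have h2 : Tendsto (fun K : ℕ => 2 * K) atTop atTop :=
    Filter.tendsto_atTop_mono (fun K : ℕ => show K ≤ 2 * K by omega) tendsto_id
  have h21 : Tendsto (fun K : ℕ => 2 * K + 1) atTop atTop :=
    Filter.tendsto_atTop_mono (fun K : ℕ => show K ≤ 2 * K + 1 by omega) tendsto_id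
  have hev : Tendsto (fun K : ℕ => ∫ V, f V ∂ρ (2 * K)) atTop (𝓝 l) := hl.comp h2
  have hod : Tendsto (fun K : ℕ => ∫ V, f V ∂ρ (2 * K + 1)) atTop (𝓝 l) := hl.comp h21
  have hev' : (fun K : ℕ => ∫ V, f V ∂ρ (2 * K)) = fun _ => ∫ V, f V ∂μ := by
    funext K; rw [hρe (2 * K) (even_two_mul K)]
  have hod' : (fun K : ℕ => ∫ V, f V ∂ρ (2 * K + 1)) = fun _ => ∫ V, f V ∂ν := by
    funext K; rw [hρo (2 * K + 1) (Nat.not_even_two_mul_add_one K)]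
  rw [hev'] at hev
  rw [hod'] at hod
  exact (tendsto_nhds_unique hev tendsto_const_nhds).symm.trans (tendsto_nhds_unique hod tendsto_const_nhds)

end Summit.QuantumFields.YangMills.Theorems.GibbsLimitUniqueness

end
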